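import Literature.MathematicalPhysics.QuantumLattice.StaggeredChiralSwapPositivity
import Literature.MathematicalPhysics.QuantumLattice.StaggeredChiralWardIdentity
import HarnessLib

/-!
# The Schwinger–Dyson equation of massless staggered fermions AT FIXED GAUGE FIELD, and the one-link
# integral with a kinetic insertion (Salmhofer–Seiler (3.44)–(3.46), (2.16)–(2.19), Grassmann level)

HONEST FRAMING (cell `pub-ymgap`, seat qcd-lit g19, `bears_on: Q1`).  Finite Grassmann algebra and ONE
Haar integral; nothing about `β`, volumes, limits or the conjecture `SalmhoferSeilerSmallBeta`.  This is
the second input (after `StaggeredChiralSwapPositivity`) of the cell's small-`β` version of Salmhofer–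
Seiler's Schwinger–Dyson lower bound (row S4 of the Y3 census): the two EXACT identities behind (4.31)
and (4.38), written so that they hold for EVERY gauge field resp. after integrating ONE link only.

* `barCharge x` — the infinitesimal charge counting the generators `ψ̄_a(x)` (all colours `a`); its charge
  operator `N_x` (the tree's `chargeOp`) is the Euler operator `∑_a ψ̄_a(x) ∂/∂ψ̄_a(x)` of Salmhofer–
  Seiler's integration by parts (2.13)/(3.45).  `N_x ψ̄ψ(y) = δ_{xy} ψ̄ψ(y)`, `N_x (ψ̄(y)Vψ(z)) = δ_{xy}(…)`.
* `kinAt x b U = N_x A_b(U_b)` — the half of the bond term of the action containing `ψ̄(x)` (the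
  "kinetic energy" insertion `-½Γ_b ψ̄(x)U_bψ(y_b)` resp. `½Γ_b ψ̄(x)U_b†ψ(x_b)`, zero unless `x ∈ b`).
* **`schwingerDyson_fixedGauge`** — for every gauge field `U`, every set `s` of links, every `F` with
  `N_x F = n F`:  `(N - n) ∫dψ̄dψ F e^{A_s(U)} = ∑_{b ∈ s} ∫dψ̄dψ F · kinAt x b U · e^{A_s(U)}`
  (`∫ N_x(·) = N ∫ (·)`: the tree's `berezin_chargeOp`; `N_x e^{A} = e^{A} N_x A`).  This is (3.46)/(4.31)
  before any gauge integration: at `β = 0` the one-link integrals turn it into Salmhofer–Seiler's SD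
  equation; at `β > 0` it is the starting point of the perturbed version.
* **The one-link integral with the insertion** (`integral_berezin_kinAt_update`): integrating the link
  variable `U_e` of ONE link against Haar,
  `∫dU_e ∫dψ̄dψ F · kinAt x e · e^{A_s} = ∫dψ̄dψ F · N_x B̃_e · e^{A_{s∖e}}`, `B̃_e = bondFactor` (the tree's
  Rossi–Wolff polynomial (2.16)–(2.17), `cintegral_linkWeightAt_staggered`), because `N_x` commutes with
  the coefficientwise Haar integral; and without insertion `∫dU_e ∫ F e^{A_s} = ∫ F B̃_e e^{A_{s∖e}}`
  (`integral_berezin_update`).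
* **`chargeOp_bar_bondFactor_eq`** — the insertion polynomial in closed form:
  `N_x B̃(¼ψ̄ψ(x)ψ̄ψ(y)) = ∑_k k a_k T^k = N · (∑_i i w_i T^i) · B̃`, `T = ψ̄ψ(x)ψ̄ψ(y)/(4N²)` (`= σ_xσ_y`),
  from the tree's `HasLog N a w` ("`B = e^{NW}` to order `N`", (2.23)/(3.44)) and `T^{N+1} = 0`.

References: M. Salmhofer, E. Seiler, CMP 139 (1991) 395, (2.13), (2.16)–(2.19), (2.23), (3.44)–(3.46),
(4.31) [SalmhoferSeiler1991]; F. A. Berezin, The Method of Second Quantization (1966), Ch. I §3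
[Berezin1966].
-/

noncomputable section

open scoped ComplexConjugate Matrix BigOperators
open MeasureTheory Finset

namespace Literature.MathematicalPhysics.QuantumLattice

namespace StrongCoupling

open GrassmannAlgebra Matrix
open Literature.MathematicalPhysics.QuantumFieldTheory (haarProbability)
open Literature.MathematicalPhysics.StatisticalMechanics (ComplexSpin.HasLog ComplexSpin.uNBondCoeff)

section BarCharge

variable {Λ : Type*} [LinearOrder Λ] [Fintype Λ] {N : ℕ}

/-- **The `ψ̄(x)`-number charge**: `1` on every generator `ψ̄_a(x)`, `0` on all other generators — the
infinitesimal generator of `ψ̄_a(x) ↦ e^s ψ̄_a(x)`, whose charge operator is the Euler operator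
`∑_a ψ̄_a(x)∂/∂ψ̄_a(x)` of the integration-by-parts formula. [cite: SalmhoferSeiler1991, (2.13) and (3.45)] -/
def barCharge (x : Λ) : CIdx Λ N ⊕ₗ CIdx Λ N → ℂ :=
  fun w => Sum.elim (fun i : CIdx Λ N => if (ofLex i).1 = x then (1 : ℂ) else 0) (fun _ => 0) (ofLex w)

omit [Fintype Λ] in
/-- The charge of `ψ̄_a(y)`. [cite: SalmhoferSeiler1991, (2.13)] -/
@[simp] theorem barCharge_barIdx (x y : Λ) (a : Fin N) :
    barCharge (N := N) x (barIdx (cidx y a)) = if y = x then 1 else 0 := rfl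

omit [Fintype Λ] in
/-- The charge of `ψ_a(y)` vanishes. [cite: SalmhoferSeiler1991, (2.13)] -/
@[simp] theorem barCharge_psiIdx (x y : Λ) (a : Fin N) : barCharge (N := N) x (psiIdx (cidx y a)) = 0 := rfl

/-- **Total charge `∑_w q_x(w) = N`** (the `N` colours of `ψ̄(x)`): `∫ N_x(·) = N ∫ (·)`. [cite: SalmhoferSeiler1991, (3.45)–(3.46)] -/
theorem sum_barCharge (x : Λ) : ∑ w, barCharge (N := N) x w = N := by
  have h1 : ∑ w, barCharge (N := N) x w = ∑ w : CIdx Λ N ⊕ CIdx Λ N, barCharge (N := N) x (toLex w) :=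
    (Fintype.sum_equiv toLex _ _ fun _ => rfl).symm
  have h2 : ∀ f : CIdx Λ N → ℂ, ∑ i : CIdx Λ N, f i = ∑ p : Λ × Fin N, f (toLex p) :=
    fun f => (Fintype.sum_equiv toLex _ _ fun _ => rfl).symm
  rw [h1, Fintype.sum_sum_type]
  simp only [barCharge, ofLex_toLex, Sum.elim_inl, Sum.elim_inr, Finset.sum_const_zero, add_zero]
  rw [h2, Fintype.sum_prod_type]
  show (∑ y : Λ, ∑ _a : Fin N, if y = x then (1 : ℂ) else 0) = (N : ℂ)
  rw [Finset.sum_comm]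
  simp

/-- `N_x ψ̄_a(y) = δ_{xy} ψ̄_a(y)`. [cite: SalmhoferSeiler1991, (3.45)] -/
theorem chargeOp_bar_psiBar (x y : Λ) (a : Fin N) :
    chargeOp ℂ (barCharge (N := N) x) (psiBar ℂ (cidx y a) : FermiAlg Λ N) =
      (if y = x then (1 : ℂ) else 0) • psiBar ℂ (cidx y a) := by
  rw [psiBar, chargeOp_gen]
  rfl

/-- `N_x ψ_a(y) = 0`. [cite: SalmhoferSeiler1991, (3.45)] -/
theorem chargeOp_bar_psi (x y : Λ) (a : Fin N) :
    chargeOp ℂ (barCharge (N := N) x) (psi ℂ (cidx y a) : FermiAlg Λ N) = 0 := by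
  rw [psi, chargeOp_gen]
  exact zero_smul _ _

/-- `N_x (ψ̄_a(y)ψ_c(z)) = δ_{xy} ψ̄_a(y)ψ_c(z)`. [cite: SalmhoferSeiler1991, (3.45)] -/
theorem chargeOp_bar_pair (x y z : Λ) (a c : Fin N) :
    chargeOp ℂ (barCharge (N := N) x) (pair (cidx y a) (cidx z c) : FermiAlg Λ N) =
      (if y = x then (1 : ℂ) else 0) • pair (cidx y a) (cidx z c) := by
  change chargeOp ℂ (barCharge x) (psiBar ℂ (cidx y a) * psi ℂ (cidx z c)) = _ • (psiBar ℂ (cidx y a) * psi ℂ (cidx z c))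
  rw [chargeOp_mul, chargeOp_bar_psiBar, chargeOp_bar_psi, mul_zero, add_zero, smul_mul_assoc]

/-- `N_x (ψ̄(y)Vψ(z)) = δ_{xy} ψ̄(y)Vψ(z)`. [cite: SalmhoferSeiler1991, (3.45)] -/
theorem chargeOp_bar_hopAt (x y z : Λ) (V : Matrix (Fin N) (Fin N) ℂ) :
    chargeOp ℂ (barCharge (N := N) x) (hopAt y z V : FermiAlg Λ N) = (if y = x then (1 : ℂ) else 0) • hopAt y z V := by
  rw [hopAt, map_sum, Finset.smul_sum]
  refine Finset.sum_congr rfl fun a _ => ?_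
  rw [map_sum, Finset.smul_sum]
  refine Finset.sum_congr rfl fun c _ => ?_
  rw [map_smul, chargeOp_bar_pair, smul_comm]

/-- `N_x ψ̄ψ(y) = δ_{xy} ψ̄ψ(y)`. [cite: SalmhoferSeiler1991, (3.45)] -/
theorem chargeOp_bar_meson (x y : Λ) :
    chargeOp ℂ (barCharge (N := N) x) (meson y : FermiAlg Λ N) = (if y = x then (1 : ℂ) else 0) • meson y := by
  rw [meson, map_sum, Finset.smul_sum]
  exact Finset.sum_congr rfl fun a _ => chargeOp_bar_pair x y y a a

/-- Charges add under products: `N F = nF`, `N G = mG` ⇒ `N(FG) = (n+m) FG`. [cite: Berezin1966, Ch. I §3] -/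
theorem chargeOp_mul_of_eq {q : CIdx Λ N ⊕ₗ CIdx Λ N → ℂ} {F G : FermiAlg Λ N} {n m : ℂ}
    (hF : chargeOp ℂ q F = n • F) (hG : chargeOp ℂ q G = m • G) : chargeOp ℂ q (F * G) = (n + m) • (F * G) := by
  rw [chargeOp_mul, hF, hG, smul_mul_assoc, mul_smul_comm, add_smul]

/-- Charges of powers: `N F = nF` ⇒ `N F^k = (k n) F^k`. [cite: Berezin1966, Ch. I §3] -/
theorem chargeOp_pow_of_eq {q : CIdx Λ N ⊕ₗ CIdx Λ N → ℂ} {F : FermiAlg Λ N} {n : ℂ} (hF : chargeOp ℂ q F = n • F) (k : ℕ) :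
    chargeOp ℂ q (F ^ k) = ((k : ℂ) * n) • F ^ k := by
  induction k with
  | zero => simp
  | succ k ih =>
    rw [pow_succ, chargeOp_mul_of_eq ih hF]
    congr 1
    push_cast
    ring

/-- Scalar multiples: `N (c F) = n (c F)` if `N F = n F`. [cite: Berezin1966, Ch. I §3] -/
theorem chargeOp_smul_of_eq {q : CIdx Λ N ⊕ₗ CIdx Λ N → ℂ} {F : FermiAlg Λ N} {n : ℂ} (hF : chargeOp ℂ q F = n • F) (c : ℂ) :
    chargeOp ℂ q (c • F) = n • (c • F) := by
  rw [map_smul, hF, smul_comm]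

/-- **`N_x (ψ̄ψ(x)ψ̄ψ(y)) = ψ̄ψ(x)ψ̄ψ(y)`** for `y ≠ x`. [cite: SalmhoferSeiler1991, (3.45)] -/
theorem chargeOp_bar_meson_mul_meson {x y : Λ} (hxy : x ≠ y) :
    chargeOp ℂ (barCharge (N := N) x) (meson x * meson y : FermiAlg Λ N) = (1 : ℂ) • (meson x * meson y) := by
  rw [chargeOp_mul_of_eq (chargeOp_bar_meson x x) (chargeOp_bar_meson x y), if_pos rfl, if_neg hxy.symm, add_zero]

/-- The same from the other end: `N_y (ψ̄ψ(x)ψ̄ψ(y)) = ψ̄ψ(x)ψ̄ψ(y)` for `x ≠ y`. [cite: SalmhoferSeiler1991, (3.45)] -/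
theorem chargeOp_bar_meson_mul_meson' {x y : Λ} (hxy : x ≠ y) :
    chargeOp ℂ (barCharge (N := N) y) (meson x * meson y : FermiAlg Λ N) = (1 : ℂ) • (meson x * meson y) := by
  rw [chargeOp_mul_of_eq (chargeOp_bar_meson y x) (chargeOp_bar_meson y y), if_neg hxy, if_pos rfl, zero_add]

/-- **`N_z (c ψ̄ψ(x)ψ̄ψ(y))^k = k (c ψ̄ψ(x)ψ̄ψ(y))^k`** for `z` an endpoint of the bond `x ≠ y`. [cite: SalmhoferSeiler1991, (3.45) and (4.31)] -/
theorem chargeOp_bar_smul_meson_mul_meson_pow {x y z : Λ} (hxy : x ≠ y) (hz : z = x ∨ z = y) (c : ℂ) (k : ℕ) :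
    chargeOp ℂ (barCharge (N := N) z) ((c • (meson x * meson y : FermiAlg Λ N)) ^ k) = (k : ℂ) • (c • (meson x * meson y)) ^ k := by
  have h1 : chargeOp ℂ (barCharge (N := N) z) (c • (meson x * meson y : FermiAlg Λ N)) = (1 : ℂ) • (c • (meson x * meson y)) := by
    rcases hz with rfl | rfl
    · exact chargeOp_smul_of_eq (chargeOp_bar_meson_mul_meson hxy) c
    · exact chargeOp_smul_of_eq (chargeOp_bar_meson_mul_meson' hxy) c
  rw [chargeOp_pow_of_eq h1, mul_one]

end BarCharge

/-! ### The kinetic insertion and the Schwinger–Dyson identity at fixed gauge field -/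

section SchwingerDyson

variable {Λ : Type*} [LinearOrder Λ] [Fintype Λ] {N : ℕ} {B : Type*}

/-- **The kinetic insertion at `x` on the link `b`**: `N_x A_b(U_b)` — the part of the bond term of the
massless action containing `ψ̄(x)`: `-½Γ_b ψ̄(x)U_bψ(y_b)` if `x = x_b`, `½Γ_b ψ̄(x)U_b†ψ(x_b)` if `x = y_b`,
`0` if `x ∉ b`. [cite: SalmhoferSeiler1991, (3.46) and (4.31)] -/
def kinAt (x : Λ) (l : B → Λ × Λ) (Γ : B → ℂ) (U : B → OneLink.UN N) (b : B) : FermiAlg Λ N :=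
  chargeOp ℂ (barCharge (N := N) x) (bondTerm l Γ U b)

/-- The kinetic insertion in closed form. [cite: SalmhoferSeiler1991, (3.46) and (4.31)] -/
theorem kinAt_eq (x : Λ) (l : B → Λ × Λ) (Γ : B → ℂ) (U : B → OneLink.UN N) (b : B) :
    kinAt x l Γ U b =
      (if (l b).1 = x then (1 : ℂ) else 0) • (-(Γ b / 2) • hopAt (l b).1 (l b).2 (U b : Matrix (Fin N) (Fin N) ℂ)) +
        (if (l b).2 = x then (1 : ℂ) else 0) • ((Γ b / 2) • hopAt (l b).2 (l b).1 (U b : Matrix (Fin N) (Fin N) ℂ)ᴴ) := by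
  rw [kinAt, bondTerm, map_add, map_smul, map_smul, chargeOp_bar_hopAt, chargeOp_bar_hopAt, smul_comm (Γ b / 2),
    smul_comm (-(Γ b / 2))]

/-- No insertion on links not containing `x`. [cite: SalmhoferSeiler1991, (3.46)] -/
theorem kinAt_eq_zero {x : Λ} {l : B → Λ × Λ} {b : B} (h1 : (l b).1 ≠ x) (h2 : (l b).2 ≠ x) (Γ : B → ℂ)
    (U : B → OneLink.UN N) : kinAt x l Γ U b = 0 := by
  rw [kinAt_eq, if_neg h1, if_neg h2, zero_smul, zero_smul, add_zero]

/-- The insertion on a link leaving `x`: `-½Γ_b ψ̄(x)U_bψ(y_b)`. [cite: SalmhoferSeiler1991, (3.46) and (4.31)] -/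
theorem kinAt_eq_of_fst {x : Λ} {l : B → Λ × Λ} {b : B} (h1 : (l b).1 = x) (h2 : (l b).2 ≠ x) (Γ : B → ℂ)
    (U : B → OneLink.UN N) : kinAt x l Γ U b = -(Γ b / 2) • hopAt x (l b).2 (U b : Matrix (Fin N) (Fin N) ℂ) := by
  rw [kinAt_eq, if_pos h1, if_neg h2, one_smul, zero_smul, add_zero, h1]

/-- The insertion on a link arriving at `x`: `½Γ_b ψ̄(x)U_b†ψ(x_b)`. [cite: SalmhoferSeiler1991, (3.46) and (4.31)] -/
theorem kinAt_eq_of_snd {x : Λ} {l : B → Λ × Λ} {b : B} (h1 : (l b).1 ≠ x) (h2 : (l b).2 = x) (Γ : B → ℂ)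
    (U : B → OneLink.UN N) : kinAt x l Γ U b = (Γ b / 2) • hopAt x (l b).1 (U b : Matrix (Fin N) (Fin N) ℂ)ᴴ := by
  rw [kinAt_eq, if_neg h1, if_pos h2, one_smul, zero_smul, zero_add, h2]

omit [Fintype Λ] in
/-- The bond term depends on the gauge field only through the link variable `U_b`. [cite: SalmhoferSeiler1991, §2 (2.3)] -/
theorem bondTerm_congr (l : B → Λ × Λ) (Γ : B → ℂ) {U U' : B → OneLink.UN N} {b : B} (h : U b = U' b) :
    bondTerm l Γ U b = bondTerm l Γ U' b := by
  unfold bondTerm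
  rw [h]

/-- So does the kinetic insertion. [cite: SalmhoferSeiler1991, (3.46)] -/
theorem kinAt_congr (x : Λ) (l : B → Λ × Λ) (Γ : B → ℂ) {U U' : B → OneLink.UN N} {b : B} (h : U b = U' b) :
    kinAt x l Γ U b = kinAt x l Γ U' b := by
  unfold kinAt
  rw [bondTerm_congr l Γ h]

/-- **`N_x A_s(U) = ∑_{b ∈ s} kinAt x b U`.** [cite: SalmhoferSeiler1991, (3.46)] -/
theorem chargeOp_bar_actionOn (x : Λ) (s : Finset B) (l : B → Λ × Λ) (Γ : B → ℂ) (U : B → OneLink.UN N) :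
    chargeOp ℂ (barCharge (N := N) x) (actionOn s l Γ U) = ∑ b ∈ s, kinAt x l Γ U b := by
  rw [actionOn, map_sum]
  rfl

/-- **The charge of the Boltzmann weight**: `N_x e^{A_s(U)} = e^{A_s(U)} · ∑_{b∈s} kinAt x b U`, every `U`. [cite: SalmhoferSeiler1991, (3.45)–(3.46)] -/
theorem chargeOp_bar_grassmannExp_actionOn (x : Λ) (s : Finset B) (l : B → Λ × Λ) (Γ : B → ℂ) (U : B → OneLink.UN N) :
    chargeOp ℂ (barCharge (N := N) x) (grassmannExp (actionOn s l Γ U)) =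
      grassmannExp (actionOn s l Γ U) * ∑ b ∈ s, kinAt x l Γ U b := by
  rw [chargeOp_grassmannExp_of_commute _ (isNilpotent_actionOn s l Γ U)
    (commute_of_mem_evenOdd_zero ℂ (actionOn_mem_evenOdd_zero s l Γ U) _), chargeOp_bar_actionOn]

/-- **The Schwinger–Dyson equation at fixed gauge field (Salmhofer–Seiler (3.46)/(4.31) before any
gauge integration).**  For every gauge field `U`, every finite set `s` of links, every site `x` and every
element `F` of the fermion algebra with `N_x F = n F` (e.g. `F = (ψ̄ψ(x)ψ̄ψ(y))^n`):
`(N - n) ∫dψ̄dψ F e^{A_s(U)} = ∑_{b ∈ s} ∫dψ̄dψ F · kinAt x b U · e^{A_s(U)}` — Grassmann integration by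
parts `∫ N_x(·) = N ∫(·)` applied to `F e^{A_s}`. [cite: SalmhoferSeiler1991, (3.44)–(3.46) and (4.31)] -/
theorem schwingerDyson_fixedGauge (x : Λ) (s : Finset B) (l : B → Λ × Λ) (Γ : B → ℂ) (U : B → OneLink.UN N)
    {F : FermiAlg Λ N} {n : ℂ} (hF : chargeOp ℂ (barCharge (N := N) x) F = n • F) :
    ((N : ℂ) - n) * berezin ℂ _ (F * grassmannExp (actionOn s l Γ U)) =
      ∑ b ∈ s, berezin ℂ _ (F * kinAt x l Γ U b * grassmannExp (actionOn s l Γ U)) := by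
  have h0 := berezin_chargeOp (barCharge (N := N) x) (F * grassmannExp (actionOn s l Γ U))
  rw [sum_barCharge, chargeOp_mul, hF, chargeOp_bar_grassmannExp_actionOn, map_add, smul_mul_assoc, map_smul,
    smul_eq_mul] at h0
  have hcomm : F * (grassmannExp (actionOn s l Γ U) * ∑ b ∈ s, kinAt x l Γ U b) =
      ∑ b ∈ s, F * kinAt x l Γ U b * grassmannExp (actionOn s l Γ U) := by
    rw [((commute_of_mem_evenOdd_zero ℂ (grassmannExp_even (actionOn_mem_evenOdd_zero s l Γ U)
      (isNilpotent_actionOn s l Γ U))) _).eq, ← mul_assoc, Finset.mul_sum, Finset.sum_mul]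
  rw [hcomm, map_sum] at h0
  linear_combination -h0

end SchwingerDyson

/-! ### One link: the action splits, and the Haar integral of the link factor (with insertion) -/

section OneLink

variable {Λ : Type*} [LinearOrder Λ] [Fintype Λ] {N : ℕ} {B : Type*} [DecidableEq B]

omit [Fintype Λ] in
/-- Off `s`, updates are invisible to `A_s`. [cite: SalmhoferSeiler1991, §2 (2.3)] -/
theorem actionOn_update_of_not_mem {s : Finset B} {e : B} (he : e ∉ s) (l : B → Λ × Λ) (Γ : B → ℂ)
    (U : B → OneLink.UN N) (g : OneLink.UN N) :
    actionOn s l Γ (Function.update U e g) = actionOn s l Γ U := by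
  unfold actionOn
  refine Finset.sum_congr rfl fun b hb => bondTerm_congr l Γ ?_
  rw [Function.update_of_ne]
  rintro rfl
  exact he hb

omit [Fintype Λ] in
/-- **Updating the link `e ∈ s`**: `A_s(U^{e←g}) = A_e(g) + A_{s∖e}(U)`. [cite: SalmhoferSeiler1991, §2 (2.3)] -/
theorem actionOn_update_eq {s : Finset B} {e : B} (he : e ∈ s) (l : B → Λ × Λ) (Γ : B → ℂ)
    (U : B → OneLink.UN N) (g : OneLink.UN N) :
    actionOn s l Γ (Function.update U e g) =
      (-(Γ e / 2) • hopAt (l e).1 (l e).2 (g : Matrix (Fin N) (Fin N) ℂ) +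
          (Γ e / 2) • hopAt (l e).2 (l e).1 (g : Matrix (Fin N) (Fin N) ℂ)ᴴ) +
        actionOn (s.erase e) l Γ U := by
  rw [actionOn, ← Finset.add_sum_erase s _ he, ← actionOn,
    actionOn_update_of_not_mem (Finset.notMem_erase e s) l Γ U g, bondTerm, Function.update_self]

/-- **The Boltzmann weight factorises at the link `e ∈ s`**:
`e^{A_s(U^{e←g})} = (e^{-½Γ_e ψ̄(x_e)gψ(y_e)} e^{½Γ_e ψ̄(y_e)g†ψ(x_e)}) · e^{A_{s∖e}(U)}`. [cite: SalmhoferSeiler1991, §2 (2.3), (2.16)] -/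
theorem grassmannExp_actionOn_update {s : Finset B} {e : B} (he : e ∈ s) (l : B → Λ × Λ) (Γ : B → ℂ)
    (U : B → OneLink.UN N) (g : OneLink.UN N) :
    grassmannExp (actionOn s l Γ (Function.update U e g)) =
      linkWeightAt (l e).1 (l e).2 (-(Γ e / 2)) (Γ e / 2) (g : Matrix (Fin N) (Fin N) ℂ) *
        grassmannExp (actionOn (s.erase e) l Γ U) := by
  rw [actionOn_update_eq he, grassmannExp_add_of_mem_evenOdd_zero
    (Submodule.add_mem _ (smul_hopAt_mem_evenOdd_zero _ _ _ _) (smul_hopAt_mem_evenOdd_zero _ _ _ _))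
    (Commute.isNilpotent_add (commute_of_mem_evenOdd_zero ℂ (smul_hopAt_mem_evenOdd_zero _ _ _ _) _)
      (isNilpotent_smul_hopAt _ _ _ _) (isNilpotent_smul_hopAt _ _ _ _)) (isNilpotent_actionOn _ l Γ U),
    linkWeightAt_eq]

omit [Fintype Λ] [DecidableEq B] in
/-- Each bond term is even. [cite: SalmhoferSeiler1991, §2 (2.3)] -/
theorem bondTerm_mem_evenOdd_zero (l : B → Λ × Λ) (Γ : B → ℂ) (U : B → OneLink.UN N) (b : B) :
    bondTerm l Γ U b ∈ evenOdd ℂ (ι := CIdx Λ N ⊕ₗ CIdx Λ N) 0 :=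
  Submodule.add_mem _ (smul_hopAt_mem_evenOdd_zero _ _ _ _) (smul_hopAt_mem_evenOdd_zero _ _ _ _)

omit [DecidableEq B] in
/-- Each bond term is nilpotent. [cite: SalmhoferSeiler1991, §2 (2.3)] -/
theorem isNilpotent_bondTerm (l : B → Λ × Λ) (Γ : B → ℂ) (U : B → OneLink.UN N) (b : B) : IsNilpotent (bondTerm l Γ U b) :=
  Commute.isNilpotent_add (commute_of_mem_evenOdd_zero ℂ (smul_hopAt_mem_evenOdd_zero _ _ _ _) _)
    (isNilpotent_smul_hopAt _ _ _ _) (isNilpotent_smul_hopAt _ _ _ _)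

/-- The kinetic insertion on the updated link times the link weight is the charge of the link weight:
`kinAt x e (U^{e←g}) · L_e(g) = N_x L_e(g)`. [cite: SalmhoferSeiler1991, (3.45)–(3.46)] -/
theorem kinAt_update_mul_linkWeightAt (x : Λ) {e : B} (l : B → Λ × Λ) (Γ : B → ℂ) (U : B → OneLink.UN N)
    (g : OneLink.UN N) :
    kinAt x l Γ (Function.update U e g) e * linkWeightAt (l e).1 (l e).2 (-(Γ e / 2)) (Γ e / 2) (g : Matrix (Fin N) (Fin N) ℂ) =
      chargeOp ℂ (barCharge (N := N) x) (linkWeightAt (l e).1 (l e).2 (-(Γ e / 2)) (Γ e / 2) (g : Matrix (Fin N) (Fin N) ℂ)) := by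
  have hA : linkWeightAt (l e).1 (l e).2 (-(Γ e / 2)) (Γ e / 2) (g : Matrix (Fin N) (Fin N) ℂ) =
      grassmannExp (bondTerm l Γ (Function.update U e g) e) := by
    rw [linkWeightAt_eq, bondTerm, Function.update_self]
  rw [hA, chargeOp_grassmannExp_of_commute _ (isNilpotent_bondTerm l Γ _ e)
    (commute_of_mem_evenOdd_zero ℂ (bondTerm_mem_evenOdd_zero l Γ _ e) _), kinAt]
  exact ((commute_of_mem_evenOdd_zero ℂ (grassmannExp_even (bondTerm_mem_evenOdd_zero l Γ _ e)
    (isNilpotent_bondTerm l Γ _ e))) _).eq.symm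

/-- On the compact group `U(N)`, coefficientwise continuity gives Haar integrability of all coordinates. [cite: SalmhoferSeiler1991, §2 (2.12)] -/
theorem coeffIntegrable_haar_of_coeffContinuous {F : OneLink.UN N → FermiAlg Λ N} (hF : CoeffContinuous F) :
    CoeffIntegrable (haarProbability (OneLink.UN N)) F := by
  haveI : SecondCountableTopology (OneLink.UN N) := by
    haveI : SecondCountableTopology (Matrix (Fin N) (Fin N) ℂ) := inferInstanceAs (SecondCountableTopology (Fin N → Fin N → ℂ))
    exact TopologicalSpace.Subtype.secondCountableTopology _
  exact hF.coeffIntegrable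

/-- **Integrating one link (no insertion)**: for `e ∈ s` with distinct endpoints and `Γ_e² = 1`,
`∫dU_e ∫dψ̄dψ F e^{A_s(U^{e←U_e})} = ∫dψ̄dψ F · B̃_e · e^{A_{s∖e}(U)}` with `B̃_e = bondFactor x_e y_e`
(Salmhofer–Seiler (2.16)–(2.19), the tree's Rossi–Wolff integral). [cite: SalmhoferSeiler1991, §2 (2.16)–(2.19)] -/
theorem integral_berezin_update {s : Finset B} {e : B} (he : e ∈ s) (l : B → Λ × Λ) (hle : (l e).1 ≠ (l e).2)
    {Γ : B → ℂ} (hΓ : Γ e ^ 2 = 1) (U : B → OneLink.UN N) (F : FermiAlg Λ N) :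
    ∫ g, berezin ℂ _ (F * grassmannExp (actionOn s l Γ (Function.update U e g))) ∂(haarProbability (OneLink.UN N)) =
      berezin ℂ _ (F * bondFactor (l e).1 (l e).2 * grassmannExp (actionOn (s.erase e) l Γ U)) := by
  have hfun : (fun g : OneLink.UN N => berezin ℂ _ (F * grassmannExp (actionOn s l Γ (Function.update U e g)))) =
      fun g : OneLink.UN N => berezin ℂ _ (F * linkWeightAt (l e).1 (l e).2 (-(Γ e / 2)) (Γ e / 2) (g : Matrix (Fin N) (Fin N) ℂ) *
        grassmannExp (actionOn (s.erase e) l Γ U)) := by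
    funext g
    rw [grassmannExp_actionOn_update he, mul_assoc]
  have hI := coeffIntegrable_haar_of_coeffContinuous (coeffContinuous_linkWeightAt (N := N) hle (-(Γ e / 2)) (Γ e / 2))
  rw [hfun, ← apply_cintegral (berezin ℂ _) (coeffIntegrable_haar_of_coeffContinuous
      (((CoeffContinuous.const F).mul (coeffContinuous_linkWeightAt hle _ _)).mul (CoeffContinuous.const _))),
    cintegral_const_mul_mul_const _ _ hI, cintegral_linkWeightAt_staggered hle (Γ e) hΓ]

/-- **Integrating one link WITH the kinetic insertion at `x`** (the gauge-integrated form of one term of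
the fixed-gauge Schwinger–Dyson equation): for `e ∈ s` with distinct endpoints and `Γ_e² = 1`,
`∫dU_e ∫dψ̄dψ F · kinAt x e · e^{A_s} = ∫dψ̄dψ F · (N_x B̃_e) · e^{A_{s∖e}(U)}` — the charge operator
`N_x` commutes with the Haar integral over `U_e`. [cite: SalmhoferSeiler1991, (3.44)–(3.46) with (2.16)–(2.19)] -/
theorem integral_berezin_kinAt_update (x : Λ) {s : Finset B} {e : B} (he : e ∈ s) (l : B → Λ × Λ)
    (hle : (l e).1 ≠ (l e).2) {Γ : B → ℂ} (hΓ : Γ e ^ 2 = 1) (U : B → OneLink.UN N) (F : FermiAlg Λ N) :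
    ∫ g, berezin ℂ _ (F * kinAt x l Γ (Function.update U e g) e * grassmannExp (actionOn s l Γ (Function.update U e g)))
        ∂(haarProbability (OneLink.UN N)) =
      berezin ℂ _ (F * chargeOp ℂ (barCharge (N := N) x) (bondFactor (l e).1 (l e).2) *
        grassmannExp (actionOn (s.erase e) l Γ U)) := by
  have hfun : (fun g : OneLink.UN N =>
      berezin ℂ _ (F * kinAt x l Γ (Function.update U e g) e * grassmannExp (actionOn s l Γ (Function.update U e g)))) =
      fun g : OneLink.UN N => berezin ℂ _ (F * chargeOp ℂ (barCharge (N := N) x)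
        (linkWeightAt (l e).1 (l e).2 (-(Γ e / 2)) (Γ e / 2) (g : Matrix (Fin N) (Fin N) ℂ)) *
          grassmannExp (actionOn (s.erase e) l Γ U)) := by
    funext g
    rw [grassmannExp_actionOn_update he, ← mul_assoc, mul_assoc F, kinAt_update_mul_linkWeightAt]
  have hI := coeffIntegrable_haar_of_coeffContinuous
    ((coeffContinuous_linkWeightAt (N := N) hle (-(Γ e / 2)) (Γ e / 2)).linearMap (chargeOp ℂ (barCharge (N := N) x)))
  rw [hfun, ← apply_cintegral (berezin ℂ _) (coeffIntegrable_haar_of_coeffContinuous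
      (((CoeffContinuous.const F).mul ((coeffContinuous_linkWeightAt hle _ _).linearMap _)).mul (CoeffContinuous.const _))),
    cintegral_const_mul_mul_const _ _ hI, ← map_cintegral _ (coeffIntegrable_haar_of_coeffContinuous
      (coeffContinuous_linkWeightAt (N := N) hle (-(Γ e / 2)) (Γ e / 2))), cintegral_linkWeightAt_staggered hle (Γ e) hΓ]

end OneLink

/-! ### The insertion polynomial `N_x B̃ = N σ_xσ_y W'(σ_xσ_y) B̃` (Salmhofer–Seiler (3.44)) -/

section Insertion

variable {Λ : Type*} [LinearOrder Λ] [Fintype Λ] {N : ℕ}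

/-- **The spin pair `σ_xσ_y = ψ̄ψ(x)ψ̄ψ(y)/(4N²)`** (`σ_x = ψ̄ψ(x)/2N`, the variable of the complex
spin system: `B̃(¼ψ̄ψ(x)ψ̄ψ(y)) = B(σ_xσ_y) = ∑_k a_k (σ_xσ_y)^k` with the tree's `uNBondCoeff`). [cite: SalmhoferSeiler1991, (2.20)–(2.23)] -/
def spinPair (x y : Λ) : FermiAlg Λ N := ((1 : ℂ) / (4 * (N : ℂ) ^ 2)) • (meson x * meson y)

omit [Fintype Λ] in
/-- `(σ_xσ_y)^{N+1} = 0` (nilpotency of `ψ̄ψ`). [cite: SalmhoferSeiler1991, Remark 3.2] -/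
theorem spinPair_pow_eq_zero (x y : Λ) : (spinPair x y : FermiAlg Λ N) ^ (N + 1) = 0 := by
  rw [spinPair, smul_pow, (commute_meson x _).mul_pow, meson_pow_eq_zero x (Nat.lt_succ_self N), zero_mul, smul_zero]

omit [Fintype Λ] in
/-- The spin pair is even. [cite: SalmhoferSeiler1991, (2.20)] -/
theorem spinPair_mem_evenOdd_zero (x y : Λ) : (spinPair x y : FermiAlg Λ N) ∈ evenOdd ℂ (ι := CIdx Λ N ⊕ₗ CIdx Λ N) 0 :=
  Submodule.smul_mem _ _ (mul_mem_evenOdd_zero (R := ℂ) (Submodule.sum_mem _ fun a _ => pair_mem_evenOdd_zero (cidx x a) (cidx x a))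
    (Submodule.sum_mem _ fun a _ => pair_mem_evenOdd_zero (cidx y a) (cidx y a)))

omit [Fintype Λ] in
/-- **`B̃(¼ψ̄ψ(x)ψ̄ψ(y)) = ∑_k a_k (σ_xσ_y)^k`** with `a_k = (N-k)!/(N!k!)·N^{2k}` the tree's `uNBondCoeff`. [cite: SalmhoferSeiler1991, (2.16)–(2.17) and (2.23)] -/
theorem bondFactor_eq_sum_spinPair_pow (hN : N ≠ 0) (x y : Λ) :
    (bondFactor x y : FermiAlg Λ N) = ∑ k ∈ Finset.range (N + 1), ((ComplexSpin.uNBondCoeff N k : ℝ) : ℂ) • spinPair x y ^ k := by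
  rw [bondFactor]
  refine Finset.sum_congr rfl fun k hk => ?_
  have hkN : k ≤ N := Nat.lt_succ_iff.mp (Finset.mem_range.mp hk)
  rw [ComplexSpin.uNBondCoeff, if_pos hkN, spinPair, smul_pow, smul_pow, smul_smul, smul_smul]
  congr 1
  have hN' : (N : ℂ) ≠ 0 := Nat.cast_ne_zero.mpr hN
  push_cast
  rw [pow_mul, mul_assoc, ← mul_pow]
  congr 2
  field_simp

/-- `N_z (σ_xσ_y)^k = k (σ_xσ_y)^k` for `z` an endpoint of the bond `x ≠ y`. [cite: SalmhoferSeiler1991, (3.45)] -/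
theorem chargeOp_bar_spinPair_pow {x y z : Λ} (hxy : x ≠ y) (hz : z = x ∨ z = y) (k : ℕ) :
    chargeOp ℂ (barCharge (N := N) z) ((spinPair x y : FermiAlg Λ N) ^ k) = (k : ℂ) • spinPair x y ^ k :=
  chargeOp_bar_smul_meson_mul_meson_pow hxy hz _ k

/-- **`N_z B̃ = ∑_k k a_k (σ_xσ_y)^k`** (`= σ_xσ_y B'(σ_xσ_y)`), `z ∈ {x, y}`, `x ≠ y`. [cite: SalmhoferSeiler1991, (3.44)–(3.45)] -/
theorem chargeOp_bar_bondFactor (hN : N ≠ 0) {x y z : Λ} (hxy : x ≠ y) (hz : z = x ∨ z = y) :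
    chargeOp ℂ (barCharge (N := N) z) (bondFactor x y : FermiAlg Λ N) =
      ∑ k ∈ Finset.range (N + 1), ((k : ℂ) * ComplexSpin.uNBondCoeff N k) • spinPair x y ^ k := by
  rw [bondFactor_eq_sum_spinPair_pow hN, map_sum]
  refine Finset.sum_congr rfl fun k _ => ?_
  rw [map_smul, chargeOp_bar_spinPair_pow hxy hz, smul_smul, mul_comm]

open Polynomial in
/-- Truncated generating polynomial `∑_{i ≤ N} f_i X^i`. [folklore] -/
private def genPoly (N : ℕ) (f : ℕ → ℂ) : ℂ[X] :=
  ∑ i ∈ Finset.range (N + 1), Polynomial.C (f i) * Polynomial.X ^ i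

omit [LinearOrder Λ] [Fintype Λ] in
/-- Coefficients of the truncated generating polynomial. [folklore] -/
private theorem coeff_genPoly (N : ℕ) (f : ℕ → ℂ) (k : ℕ) :
    (genPoly N f).coeff k = if k < N + 1 then f k else 0 := by
  unfold genPoly
  rw [Polynomial.finsetSum_coeff]
  simp_rw [Polynomial.coeff_C_mul_X_pow]
  rw [Finset.sum_ite_eq (Finset.range (N + 1)) k]
  simp only [Finset.mem_range]

omit [LinearOrder Λ] [Fintype Λ] in
/-- Evaluating the truncated generating polynomial. [folklore] -/
private theorem aeval_genPoly {A : Type*} [Semiring A] [Algebra ℂ A] (N : ℕ) (f : ℕ → ℂ) (T : A) :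
    Polynomial.aeval T (genPoly N f) = ∑ i ∈ Finset.range (N + 1), f i • T ^ i := by
  unfold genPoly
  rw [map_sum]
  refine Finset.sum_congr rfl fun i _ => ?_
  rw [map_mul, map_pow, Polynomial.aeval_C, Polynomial.aeval_X, Algebra.smul_def]

omit [LinearOrder Λ] [Fintype Λ] in
/-- `t B'(t) - N t W'(t) B(t)` is divisible by `t^{N+1}` under `HasLog` (coefficient form of
`B = exp(NW)` to order `N`). [cite: SalmhoferSeiler1991, (3.44) and Remark 3.2] -/
private theorem X_pow_dvd_of_hasLog {a w : ℕ → ℝ} (hlog : ComplexSpin.HasLog N a w) :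
    Polynomial.X ^ (N + 1) ∣
      Polynomial.C (N : ℂ) * genPoly N (fun j => (j : ℂ) * w j) * genPoly N (fun j => ((a j : ℝ) : ℂ)) -
        genPoly N (fun k => (k : ℂ) * a k) := by
  rw [Polynomial.X_pow_dvd_iff]
  intro d hd
  rw [Polynomial.coeff_sub, mul_assoc, Polynomial.coeff_C_mul, Polynomial.coeff_mul, coeff_genPoly, if_pos hd]
  have h1 : ∑ p ∈ Finset.HasAntidiagonal.antidiagonal d,
      (genPoly N (fun j => (j : ℂ) * w j)).coeff p.1 * (genPoly N fun j => ((a j : ℝ) : ℂ)).coeff p.2 =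
      ∑ p ∈ Finset.HasAntidiagonal.antidiagonal d, (p.1 : ℂ) * w p.1 * a p.2 := by
    refine Finset.sum_congr rfl fun p hp => ?_
    have hp' : p.1 + p.2 = d := Finset.HasAntidiagonal.mem_antidiagonal.mp hp
    rw [coeff_genPoly, coeff_genPoly, if_pos (by omega), if_pos (by omega)]
  rw [h1]
  rcases Nat.eq_zero_or_pos d with rfl | hd1
  · rw [Finset.Nat.antidiagonal_zero, Finset.sum_singleton]
    simp
  · have h := congrArg (fun r : ℝ => (r : ℂ)) (hlog d hd1 (by omega))
    push_cast at h
    rw [← h, sub_self]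

omit [LinearOrder Λ] [Fintype Λ] in
/-- **`∑_k k a_k T^k = N (∑_i i w_i T^i)(∑_j a_j T^j)` whenever `T^{N+1} = 0`** — `t B'(t) = N t W'(t) B(t)`
to order `N`, for any element `T` of a `ℂ`-algebra (here `T = σ_xσ_y`). [cite: SalmhoferSeiler1991, (3.44) and Remark 3.2] -/
theorem sum_smul_pow_eq_of_hasLog {A : Type*} [Ring A] [Algebra ℂ A] {a w : ℕ → ℝ} (hlog : ComplexSpin.HasLog N a w)
    {T : A} (hT : T ^ (N + 1) = 0) :
    ∑ k ∈ Finset.range (N + 1), ((k : ℂ) * a k) • T ^ k =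
      (N : ℂ) • ((∑ i ∈ Finset.range (N + 1), ((i : ℂ) * w i) • T ^ i) *
        ∑ j ∈ Finset.range (N + 1), ((a j : ℝ) : ℂ) • T ^ j) := by
  obtain ⟨q, hq⟩ := X_pow_dvd_of_hasLog (N := N) hlog
  have h := congrArg (Polynomial.aeval T) hq
  simp only [map_sub, map_mul, Polynomial.aeval_C, map_pow, Polynomial.aeval_X, hT, zero_mul, aeval_genPoly] at h
  rw [Algebra.smul_def, ← mul_assoc]
  exact (sub_eq_zero.mp h).symm

/-- **The insertion polynomial in closed form (Salmhofer–Seiler (3.44)–(3.45))**: if the bond data have a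
logarithm to order `N` with coefficients `w` (`HasLog N a w`, e.g. the printed `w_k` for `N ≤ 4`), then
for `z ∈ {x, y}`, `x ≠ y`:  `N_z B̃ = N · (∑_i i w_i (σ_xσ_y)^i) · B̃` — i.e. `σ_xσ_y W'(σ_xσ_y)` times `N B̃`. [cite: SalmhoferSeiler1991, (3.44)–(3.46)] -/
theorem chargeOp_bar_bondFactor_eq_of_hasLog (hN : N ≠ 0) {x y z : Λ} (hxy : x ≠ y) (hz : z = x ∨ z = y)
    {w : ℕ → ℝ} (hlog : ComplexSpin.HasLog N (ComplexSpin.uNBondCoeff N) w) :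
    chargeOp ℂ (barCharge (N := N) z) (bondFactor x y : FermiAlg Λ N) =
      (N : ℂ) • ((∑ i ∈ Finset.range (N + 1), ((i : ℂ) * w i) • spinPair x y ^ i) * bondFactor x y) := by
  rw [chargeOp_bar_bondFactor hN hxy hz, sum_smul_pow_eq_of_hasLog hlog (spinPair_pow_eq_zero x y),
    ← bondFactor_eq_sum_spinPair_pow hN]

end Insertion

end StrongCoupling

end Literature.MathematicalPhysics.QuantumLattice
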